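import Summits.NavierStokesRegularity.NavierStokesRegularity.Theses.HardyPointSink
import Literature.Analysis.FluidPDE.LocalTypeIMorreyProofs
import Literature.Analysis.FluidPDE.LocalTypeIScaling
import Literature.Analysis.FluidPDE.SuitableWeakInBallTools

/-!
# Route HardyPointSink — support `ScaledEnergyControlsTypeI` (item stmt-NavierStokesRegularity-7981)

Bounded scaled energy `A` on all parabolic sub-balls of `Q(z, r₀)` upgrades, for a suitable weak
solution in the parabolic ball `Q(z, r₀)` (Albritton–Barker 2019, Def. 2.1), to a finite Type I
quantity `𝐈(Q(z, r₀/2)) < ∞` (Seregin 2006, Lemma 2.1(c) = Seregin 2014, Prop. 3.11(ii) =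
Albritton–Barker 2019, Lemma 2.6, `A`-case).

The unit-scale statement is the tree's PROVED fact
`Literature.Analysis.FluidPDE.albrittonBarker2019_lemma_2_6_holds` (`LocalTypeIMorreyProofs.lean`).
This file is the scaling bookkeeping around it: the Navier–Stokes zoom
`U(s, y) = r₀ u(t + r₀² s, x + r₀ y)`, `P = r₀² p ∘ Φ`, `Φ = stAffine (r₀²) r₀ t x`, carries the
class `IsSuitableWeakSolutionInBall r₀ z` to `IsSuitableWeakSolutionInBall 1 0`
(`IsSuitableWeakSolutionInBall.zoom`), the packaged weak gradient `G` of `u` to the weak gradient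
`r₀² G ∘ Φ` of `U` (`HasWeakSpatialGradientOn.stRescale`), the hypothesis
`A(Q(z', r)) ≤ K` for `Q(z', r) ⊆ Q(z, r₀)` to the same bound on all sub-balls of `Q(0, 1)`
(`cknAEss_nsZoom`), and the conclusion `𝐈(Q(0, 1/2); U, P, ∇U) < ∞` back to
`𝐈(Q(z, r₀/2); u, p, G) < ∞` (`typeIBound_nsZoom`, `zoom_preimage_parabolicCylinder_half`).

## References

* D. Albritton, T. Barker, J. Math. Fluid Mech. 21 (2019), arXiv:1811.00502, Def. 2.1 and
  Lemma 2.6. [AlbrittonBarker2019]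
* G. Seregin, arXiv:math/0607537, Lemma 2.1(c); *Lecture Notes on Regularity Theory for the
  Navier–Stokes Equations* (2014), Prop. 3.11(ii). [Seregin2006, Seregin2014]
-/

noncomputable section

namespace Summit.NavierStokesRegularity.NavierStokesRegularity.Theorems

open Set MeasureTheory Function TopologicalSpace Metric
open Literature.Analysis.FluidPDE
open scoped ENNReal NNReal

-- single-problem summit: the mandated namespace `Summit.NavierStokesRegularity.NavierStokesRegularity.…`
-- repeats the summit name by design (CONVENTIONS §1), which the `dupNamespace` linter flags.
set_option linter.dupNamespace false

/-- **Item stmt-NavierStokesRegularity-7981 (`ScaledEnergyControlsTypeI`) holds.** If `(u, p)`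
is a suitable weak solution in the parabolic ball `Q(z, r₀)`, `r₀ > 0`
(`IsSuitableWeakSolutionInBall`, Albritton–Barker 2019, Def. 2.1) and the essential-sup scaled
energy `A(Q(z', r)) = cknAEss r z' u` is bounded by one constant `K` over all parabolic
sub-balls `Q(z', r) ⊆ Q(z, r₀)`, then for the weak spatial gradient `G` of `u` on `Q(z, r₀)`
packaged in the class, Albritton–Barker's Type I quantity of the half ball is finite:
`typeIBound (Q(z, r₀/2)) u p G < ⊤`. Proof: Navier–Stokes zoom to `Q(0, 1)` and the `A`-case of
the proved fact `albrittonBarker2019_lemma_2_6_holds` (Seregin 2006, Lemma 2.1(c)) at `R = 1/2`,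
transported back by the scale invariance of `A` and `𝐈`.
[cite: AlbrittonBarker2019, Lemma 2.6; Seregin2006, Lemma 2.1(c)] -/
theorem hardyPointSink_scaledEnergyControlsTypeI_proof :
    Summit.NavierStokesRegularity.NavierStokesRegularity.Theses.HardyPointSink.ScaledEnergyControlsTypeI := by
  intro r₀ z u p hr₀ hsw hA
  obtain ⟨K, hK⟩ := hA
  obtain ⟨G, hG, -⟩ := hsw.2.2.1
  refine ⟨G, hG, ?_⟩
  have hr₀2 : 0 < r₀ ^ 2 := pow_pos hr₀ 2
  -- the zoomed pair is a suitable weak solution in `Q(0, 1)`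
  have hzoom := hsw.zoom hr₀
  -- the zoomed gradient
  have hGz : HasWeakSpatialGradientOn
      (parabolicCylinderOpens 1 (0 : ℝ × EuclideanSpace ℝ (Fin 3)))
      (r₀ • stPull (r₀ ^ 2) r₀ z.1 z.2 u) (r₀ ^ 2 • stPull (r₀ ^ 2) r₀ z.1 z.2 G) := by
    have h := hG.stRescale r₀ hr₀2 hr₀ z.1 z.2
    rw [zoom_stPreimage_parabolicCylinderOpens hr₀ z, ← pow_two] at h
    exact h
  -- surjectivity of the zoom map
  have hsurj : Function.Surjective (stAffine (r₀ ^ 2) r₀ z.1 z.2 :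
      ℝ × EuclideanSpace ℝ (Fin 3) → ℝ × EuclideanSpace ℝ (Fin 3)) :=
    (stAffineHomeomorph (pow_ne_zero 2 hr₀.ne') hr₀.ne' z.1 z.2).surjective
  -- the scaled energies of the zoom are bounded by `K` on every parabolic sub-ball of `Q(0, 1)`
  have hAsup : (⨆ (r : ℝ) (_ : 0 < r) (z' : ℝ × EuclideanSpace ℝ (Fin 3))
      (_ : parabolicCylinder r z' ⊆ parabolicCylinder 1 (0 : ℝ × EuclideanSpace ℝ (Fin 3))),
        cknAEss r z' (r₀ • stPull (r₀ ^ 2) r₀ z.1 z.2 u)) < ∞ := by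
    refine lt_of_le_of_lt ?_ (ENNReal.coe_lt_top (r := K))
    refine iSup_le fun r => iSup_le fun hr => iSup_le fun z' => iSup_le fun hz' => ?_
    rw [cknAEss_nsZoom hr₀ hr z.1 z.2 z' u]
    refine hK (r₀ * r) (mul_pos hr₀ hr) _ ?_
    intro w hw
    obtain ⟨w', rfl⟩ := hsurj w
    have hw' : w' ∈ parabolicCylinder r z' := by
      rw [← LocalTypeIScaling.stAffine_preimage_parabolicCylinder hr₀ z.1 z.2 r z']
      exact hw
    have h1 := hz' hw'
    rw [← zoom_preimage_parabolicCylinder_self hr₀ z] at h1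
    exact h1
  -- Albritton–Barker Lemma 2.6 (`A`-case) at `R = 1/2`
  have hT := albrittonBarker2019_lemma_2_6_holds 0 _ _ hzoom _ hGz (Or.inl hAsup) (1 / 2)
    (by norm_num) (by norm_num)
  rw [← zoom_preimage_parabolicCylinder_half hr₀ z, typeIBound_nsZoom hr₀ z.1 z.2 _ u p G] at hT
  exact hT

end Summit.NavierStokesRegularity.NavierStokesRegularity.Theorems

end
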